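import Literature.Geometry.Riemannian.SimpleAHBoundarySphereProofs
import HarnessLib

/-!
# The boundary at infinity of a non-trapping, convex-near-infinity asymptotically hyperbolic
# manifold with `K ≤ 0` is a sphere — GGSU 2019, Prop. 5.13 (corollary), with the convexity input
# abstracted and a compactified metric of arbitrary regularity

Support file (everything proved, no definitions, no named facts) generalising the discharge
`Literature.Geometry.Riemannian.ggsu_boundary_sphere_of_nonTrapping_of_nonpos_holds`
(`SimpleAHBoundarySphereProofs.lean`; C. R. Graham, C. Guillarmou, P. Stefanov, G. Uhlmann, *X-ray
transform and boundary rigidity for asymptotically hyperbolic manifolds*, Ann. Inst. Fourier 69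
(2019), Prop. 5.13 with the remark after Def. 5.3, p. 3 and p. 10).

That discharge uses the SMOOTHNESS of the compactified metric `ḡ` at exactly one place: the
convexity of the regions `{ρ ≥ ε}` for small `ε` (`SimpleAH.exists_convexity_threshold`,
`AHConvexNearInfinity.lean`; GGSU p. 10: "the regions `{ρ ≥ ε}` are strictly convex with respect to
the flow for `ε > 0` small enough"). Everything else — completeness of `g` (Mazzeo 1988, §1; the
tree's `SimpleAH.isGeodesicallyComplete_of_conformallyCompact`, any compactified regularity), the
Cartan–Hadamard covering `exp_p`, the exit structure of the rays from `p`
(`SimpleAH.exit_structure`), the injectivity of `exp_p` from the saturated star-shaped ball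
(`SimpleAH.injective_of_star`) and Milnor's collar of `∂X̄` along `ρ`
(`SimpleAH.exists_openCollarData_of_bdf`) — is blind to the regularity of `ḡ`. Hence:

* `SimpleAH.boundary_sphere_of_convex_of_nonTrapping_of_nonpos` — **for a connected `(N, g)` which
  is asymptotically hyperbolic with a compactified metric `ḡ` of ANY class `k` (compact `X̄`,
  `j : N ≅ int X̄`, `ι : B ≅ ∂X̄` with `B` closed, smooth bdf `ρ`, `|dρ|_ḡ = 1` on `∂X̄`,
  `j^*ḡ = ρ² g`), CONVEX NEAR INFINITY (along unit speed geodesics `ρ ∘ j` has no interior minimum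
  below `ε₀`), NON-TRAPPING and with `K ≤ 0` on orthonormal pairs, `B ≅ Sⁿ`.**

This is the form consumed at `C²` compactified regularity (Li–Qing–Shi 2017, Def. 2.1: conformally
compact Einstein metrics are `C²`-conformally compact; their compactifications are polyhomogeneous,
not smooth, in even boundary dimension — Chruściel–Delay–Lee–Skinner 2005) by the recognisers
`Summit.SmoothPoincare4.SmoothPoincare4.Theses.EinsteinBulk.EinsteinHadamardFillingStandard` /
`….HadamardFillingStandard`, whose convexity and non-trapping inputs are separate route items.

## References

* C. R. Graham, C. Guillarmou, P. Stefanov, G. Uhlmann, Ann. Inst. Fourier 69 (2019) 2857–2919,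
  doi:10.5802/aif.3339 (arXiv:1709.05053): p. 3, p. 10, Def. 5.3 and remark (p. 27), Prop. 5.13
  (p. 30). [GrahamEtAl2020]
* R. Mazzeo, *The Hodge cohomology of a conformally compact metric*, J. Differential Geom. 28
  (1988) 309–339, §1.
* J. M. Lee, *Introduction to Riemannian Manifolds* (2018), Thm. 12.8. [Lee2018]
* J. Milnor, *Lectures on the h-cobordism theorem* (1965), proof of Thm. 3.4. [MilnorHCobordism1965]
* G. Li, J. Qing, Y. Shi, Trans. Amer. Math. Soc. 369 (2017), Def. 2.1 (arXiv:1410.6402).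
  [LiQingShi2017]
-/

noncomputable section

open Bundle Set Filter Function Metric TopologicalSpace
open scoped Manifold ContDiff Topology

namespace Literature.Geometry.Riemannian

namespace SimpleAH

open Literature.Geometry.Lorentzian
open Literature.Geometry.Lorentzian.PseudoRiemannianMetric
open Literature.Topology.FourManifolds

set_option maxSynthPendingDepth 3 in
set_option maxHeartbeats 800000 in
/-- **Graham–Guillarmou–Stefanov–Uhlmann (Ann. Inst. Fourier 69 (2019), corollary of Prop. 5.13
with the remark after Def. 5.3), convexity input abstracted, any compactified regularity**: let
`(N, g)` be a connected Riemannian `(m+2)`-manifold, asymptotically hyperbolic with respect to a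
compactification `X̄` (`j : N ≅ int X̄`, `ι : B ≅ ∂X̄`, `B` a closed `(m+1)`-manifold, smooth
boundary defining function `ρ`, compactified metric `ḡ` of class `k` with `|dρ|_ḡ = 1` on `∂X̄` and
`j^*ḡ = ρ² g`). If `g` is convex near infinity with threshold `ε₀` (along every geodesic, at a unit
speed parameter where `ρ ∘ j < ε₀` and `(ρ ∘ j ∘ γ)' = 0` one has `(ρ ∘ j ∘ γ)'' < 0`),
non-trapping (every non-constant geodesic eventually leaves every compact set) and has `K ≤ 0` on
orthonormal pairs, then `B` is diffeomorphic to the sphere `Sᵐ⁺¹`. The proof is the tree's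
discharge of the smooth case verbatim, with the convexity threshold taken as a hypothesis instead
of from `exists_convexity_threshold`. [cite: GrahamEtAl2020, Prop. 5.13 (p. 30), Def. 5.3 and remark (p. 27), p. 10] -/
theorem boundary_sphere_of_convex_of_nonTrapping_of_nonpos {m : ℕ} {k : ℕ∞ω}
    {B : Type} [TopologicalSpace B] [T2Space B] [SecondCountableTopology B]
    [ChartedSpace (EuclideanSpace ℝ (Fin (m + 1))) B] [IsManifold (𝓡 (m + 1)) ∞ B] [CompactSpace B]
    {N : Type} [TopologicalSpace N] [T2Space N] [SecondCountableTopology N] [ConnectedSpace N]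
    [ChartedSpace (EuclideanSpace ℝ (Fin (m + 1 + 1))) N] [IsManifold (𝓡 (m + 1 + 1)) ∞ N]
    (g : Bundle.ContMDiffRiemannianMetric (𝓡 (m + 1 + 1)) ∞ (EuclideanSpace ℝ (Fin (m + 1 + 1)))
      (TangentSpace (𝓡 (m + 1 + 1)) : N → Type _))
    [(PseudoRiemannianMetric.ofRiemannian g).HasLeviCivita]
    {X : Type} [TopologicalSpace X] [T2Space X] [SecondCountableTopology X]
    [ChartedSpace (EuclideanHalfSpace (m + 1 + 1)) X] [IsManifold (𝓡∂ (m + 1 + 1)) ∞ X]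
    [CompactSpace X] {j : N → X} {ι : B → X} {ρ : X → ℝ}
    (gb : Bundle.ContMDiffRiemannianMetric (𝓡∂ (m + 1 + 1)) k (EuclideanSpace ℝ (Fin (m + 1 + 1)))
      (TangentSpace (𝓡∂ (m + 1 + 1)) : X → Type _))
    (hj : Manifold.IsSmoothEmbedding (𝓡 (m + 1 + 1)) (𝓡∂ (m + 1 + 1)) ∞ j)
    (hjr : Set.range j = (𝓡∂ (m + 1 + 1)).interior X)
    (hι : Manifold.IsSmoothEmbedding (𝓡 (m + 1)) (𝓡∂ (m + 1 + 1)) ∞ ι)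
    (hιr : Set.range ι = (𝓡∂ (m + 1 + 1)).boundary X)
    (hρs : ContMDiff (𝓡∂ (m + 1 + 1)) 𝓘(ℝ, ℝ) ∞ ρ) (hρ0 : ∀ x : X, 0 ≤ ρ x)
    (hρb : ∀ x : X, ρ x = 0 ↔ x ∈ (𝓡∂ (m + 1 + 1)).boundary X)
    (hν : ∀ y : B, ∃ ν : TangentSpace (𝓡∂ (m + 1 + 1)) (ι y), gb.inner (ι y) ν ν = 1 ∧
      ∀ v : TangentSpace (𝓡∂ (m + 1 + 1)) (ι y),
        gb.inner (ι y) ν v = mfderiv (𝓡∂ (m + 1 + 1)) 𝓘(ℝ, ℝ) ρ (ι y) v)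
    (hconf : ∀ (x : N) (v w : TangentSpace (𝓡 (m + 1 + 1)) x),
      gb.inner (j x) (mfderiv (𝓡 (m + 1 + 1)) (𝓡∂ (m + 1 + 1)) j x v)
        (mfderiv (𝓡 (m + 1 + 1)) (𝓡∂ (m + 1 + 1)) j x w) = ρ (j x) ^ 2 * g.inner x v w)
    {ε₀ : ℝ} (hε₀ : 0 < ε₀)
    (hconv : ∀ γ : ℝ → N, IsGeodesic (PseudoRiemannianMetric.ofRiemannian g).leviCivita γ →
      ∀ t : ℝ, g.inner (γ t) (velocity (𝓡 (m + 1 + 1)) γ t) (velocity (𝓡 (m + 1 + 1)) γ t) = 1 →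
        ρ (j (γ t)) < ε₀ → deriv (fun s ↦ ρ (j (γ s))) t = 0 →
        deriv (deriv fun s ↦ ρ (j (γ s))) t < 0)
    (hNT : ∀ γ : ℝ → N, IsGeodesic (PseudoRiemannianMetric.ofRiemannian g).leviCivita γ →
      velocity (𝓡 (m + 1 + 1)) γ 0 ≠ 0 →
      ∀ K : Set N, IsCompact K → ∃ T : ℝ, ∀ t : ℝ, T ≤ t → γ t ∉ K)
    (hsec : ∀ (x : N) (X Y : TangentSpace (𝓡 (m + 1 + 1)) x), g.inner x X X = 1 →
      g.inner x Y Y = 1 → g.inner x X Y = 0 →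
      (PseudoRiemannianMetric.ofRiemannian g).curvatureForm
        (PseudoRiemannianMetric.ofRiemannian g).leviCivita x X Y Y X ≤ 0) :
    Nonempty (B ≃ₘ⟮𝓡 (m + 1), 𝓡 (m + 1)⟯ Metric.sphere (0 : EuclideanSpace ℝ (Fin (m + 1 + 1))) 1) := by
  -- the metrics as pseudo-Riemannian metrics of the tree
  set G := PseudoRiemannianMetric.ofRiemannian g with hGdef
  have hGr : G.IsRiemannian := isRiemannian_ofRiemannian g
  set Gb := PseudoRiemannianMetric.ofRiemannian gb with hGbdef
  have hGbr : Gb.IsRiemannian := isRiemannian_ofRiemannian gb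
  have hk1 : ((1 : ℕ∞) : ℕ∞ω) + 1 ≤ ∞ := by
    rw [show ((1 : ℕ∞) : ℕ∞ω) + 1 = 2 by norm_num]
    exact WithTop.coe_le_coe.2 le_top
  have hktop : ((⊤ : ℕ∞) : ℕ∞ω) + 1 ≤ ∞ := le_of_eq rfl
  have h2 : (2 : ℕ∞ω) ≤ ∞ := WithTop.coe_le_coe.2 le_top
  haveI : CovariantDerivative.ContMDiffCovariantDerivative G.leviCivita 1 :=
    ⟨G.isLocallyContMDiff_leviCivita_holds 1 hk1 univ isOpen_univ⟩
  haveI : CovariantDerivative.ContMDiffCovariantDerivative G.leviCivita ∞ :=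
    ⟨G.isLocallyContMDiff_leviCivita_holds ⊤ hktop univ isOpen_univ⟩
  -- (1) sectional curvature on all pairs
  have hsec' : ∀ (x : N) (X Y : TangentSpace (𝓡 (m + 1 + 1)) x),
      G.curvatureForm G.leviCivita x X Y Y X ≤ 0 :=
    curvatureForm_leviCivita_nonpos_of_orthonormal h2 hGr
      (fun x X Y hX hY hXY ↦ hsec x X Y hX hY hXY)
  -- (2) completeness (any compactified regularity)
  have hconf₁ : ∀ (x : N) (v : TangentSpace (𝓡 (m + 1 + 1)) x),
      Gb.val (j x) (mfderiv (𝓡 (m + 1 + 1)) (𝓡∂ (m + 1 + 1)) j x v)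
        (mfderiv (𝓡 (m + 1 + 1)) (𝓡∂ (m + 1 + 1)) j x v) = ρ (j x) ^ 2 * G.val x v v :=
    fun x v ↦ hconf x v v
  have hc : IsGeodesicallyComplete G.leviCivita :=
    isGeodesicallyComplete_of_conformallyCompact G h2 hGr Gb hGbr
      (hj.contMDiff.of_le (by simp)) hj.isEmbedding hjr (hρs.of_le (by simp)) hρ0 hρb hconf₁
  -- (3) convexity near infinity: the hypothesis, in the tree's format
  have hconv : ∀ γ : ℝ → N, IsGeodesic G.leviCivita γ → ∀ t : ℝ,
      G.val (γ t) (velocity (𝓡 (m + 1 + 1)) γ t) (velocity (𝓡 (m + 1 + 1)) γ t) = 1 →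
      ρ (j (γ t)) < ε₀ → deriv (fun s ↦ ρ (j (γ s))) t = 0 →
      deriv (deriv fun s ↦ ρ (j (γ s))) t < 0 :=
    fun γ hγ t h1 hlt hd ↦ hconv γ hγ t h1 hlt hd
  -- (4) base point, the function `u = ρ ∘ j`, properness
  obtain ⟨p⟩ : Nonempty N := inferInstance
  set u : N → ℝ := fun x ↦ ρ (j x) with hu_def
  have hu : ContMDiff (𝓡 (m + 1 + 1)) 𝓘(ℝ, ℝ) ∞ u := hρs.comp hj.contMDiff
  have hje : Topology.IsEmbedding j := hj.isEmbedding
  have hupos : ∀ x : N, 0 < u x := by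
    intro x
    have hx : j x ∈ (𝓡∂ (m + 1 + 1)).interior X := hjr ▸ mem_range_self x
    have hnb : j x ∉ (𝓡∂ (m + 1 + 1)).boundary X := fun hb ↦
      Set.disjoint_left.1 ModelWithCorners.disjoint_interior_boundary hx hb
    exact lt_of_le_of_ne (hρ0 _) fun h0 ↦ hnb ((hρb _).1 h0.symm)
  have hprop : ∀ s : ℝ, 0 < s → IsCompact {x : N | s ≤ u x} := by
    intro s hs
    have hclosed : IsClosed {y : X | s ≤ ρ y} := isClosed_le continuous_const hρs.continuous
    have h := hje.isInducing.isCompact_preimage' hclosed.isCompact (fun y (hy : s ≤ ρ y) ↦ by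
      rw [hjr, ← ModelWithCorners.compl_boundary]
      intro hb
      have h0 : ρ y = 0 := (hρb y).2 hb
      linarith)
    exact h
  -- (5) Cartan–Hadamard: `exp_p`
  obtain ⟨hFs, hFloc, hFsurj, hFcov⟩ := exp_covering_of_complete hGr hc hsec' p
  set F : EuclideanSpace ℝ (Fin (m + 1 + 1)) → N :=
    fun w ↦ expMap G.leviCivita p (show TangentSpace (𝓡 (m + 1 + 1)) p from w) with hFdef
  have hF0 : F 0 = p := expMap_zero (cov := G.leviCivita) p
  -- the boundary is nonempty (otherwise `N` would be compact, contradicting non-trapping)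
  have hBne : Nonempty B := by
    by_contra hBe
    rw [not_nonempty_iff] at hBe
    have hbd : (𝓡∂ (m + 1 + 1)).boundary X = ∅ := by
      rw [← hιr, Set.range_eq_empty_iff]; exact hBe
    -- `N` is compact
    have hNc : IsCompact (univ : Set N) := by
      have h1 : {x : N | u p ≤ u x} ⊆ univ := subset_univ _
      have huniv : (univ : Set N) = j ⁻¹' (univ : Set X) := by simp
      have hXc : IsCompact (univ : Set X) := isCompact_univ
      refine hje.isInducing.isCompact_preimage' hXc ?_ |>.of_isClosed_subset isClosed_univ (by simp)
      intro y _
      rw [hjr, ← ModelWithCorners.compl_boundary, hbd, compl_empty]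
      exact mem_univ y
    -- a non-constant geodesic cannot leave the compact `N`
    obtain ⟨c0, hc0, hcv⟩ := exists_pos_mul_norm_sq_le_val_point (g := G) hGr p
    obtain ⟨v₀, hv₀⟩ : ∃ v₀ : EuclideanSpace ℝ (Fin (m + 1 + 1)), v₀ ≠ 0 := exists_ne 0
    obtain ⟨-, hgeo, h0, hv0⟩ := maximalGeodesic_of_isGeodesicallyComplete hc p
      (show TangentSpace (𝓡 (m + 1 + 1)) p from v₀)
    obtain ⟨T, hT⟩ := hNT _ hgeo (by rw [hv0]; exact hv₀) univ hNc
    exact hT T le_rfl (mem_univ _)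
  haveI := hBne
  -- (6) the collar of `∂X` along `ρ`
  set b : BoundaryData (𝓡∂ (m + 1 + 1)) X (𝓡 (m + 1)) :=
    { carrier := B, incl := ι, isSmoothEmbedding := hι, range_incl := hιr } with hb
  have hreg : ∀ z, ρ z = 0 → mfderiv (𝓡∂ (m + 1 + 1)) 𝓘(ℝ, ℝ) ρ z ≠ 0 := by
    intro z hz h0
    have hzb : z ∈ (𝓡∂ (m + 1 + 1)).boundary X := (hρb z).1 hz
    rw [← hιr] at hzb
    obtain ⟨y, rfl⟩ := hzb
    obtain ⟨ν, hν1, hν2⟩ := hν y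
    have h1 := hν2 ν
    rw [h0, hν1] at h1
    have h2 : (1 : ℝ) = 0 := h1
    exact one_ne_zero h2
  obtain ⟨a, c, ha, hcreg, hctop, hcheight⟩ := exists_openCollarData_of_bdf b hρs hρ0 hρb hreg
  -- (7) the level `ε`
  set ε : ℝ := min (min ε₀ (u p)) a / 2 with hε_def
  have hεpos : 0 < ε := by
    have : 0 < min (min ε₀ (u p)) a := lt_min (lt_min hε₀ (hupos p)) ha
    positivity
  have hεε₀ : ε < ε₀ := by
    have : min (min ε₀ (u p)) a ≤ ε₀ := (min_le_left _ _).trans (min_le_left _ _)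
    rw [hε_def]; linarith
  have hεp : ε < u p := by
    have : min (min ε₀ (u p)) a ≤ u p := (min_le_left _ _).trans (min_le_right _ _)
    rw [hε_def]; linarith [hupos p]
  have hεa : ε < a := by
    have : min (min ε₀ (u p)) a ≤ a := min_le_right _ _
    rw [hε_def]; linarith
  -- (8) exit structure of the rays from `p`
  set K : Set (EuclideanSpace ℝ (Fin (m + 1 + 1))) := {w | ε ≤ u (F w)} with hK
  obtain ⟨U, τ, hUo, hSU, hτd, hstruct, h0K, hstar, ⟨eK⟩⟩ :=
    exit_structure hc hGr hu hNT hprop hconv p hεpos hεε₀ hεp (K := K) hK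
  -- (9) `exp_p` is a diffeomorphism
  haveI : LocallyPathConnectedSpace N :=
    ChartedSpace.locallyPathConnectedSpace (EuclideanSpace ℝ (Fin (m + 1 + 1))) N
  haveI : PathConnectedSpace N := pathConnectedSpace_iff_connectedSpace.2 inferInstance
  have hsat : ∀ w, F w ∈ F '' K → w ∈ K := by
    rintro w ⟨w', hw', hww'⟩
    show ε ≤ u (F w)
    rw [← hww']
    exact hw'
  have hFinj : Injective F := injective_of_star hFcov h0K hstar hsat eK
  set Φ := hFloc.diffeomorphOfBijective ⟨hFinj, hFsurj⟩ with hΦ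
  have hΦapp : ∀ w, Φ w = F w := fun w ↦ rfl
  have hΦsymm : ∀ w, Φ.symm (F w) = w := fun w ↦ by
    rw [← hΦapp]; exact Φ.symm_apply_apply w
  have hΦsymm' : ∀ q, F (Φ.symm q) = q := fun q ↦ by
    rw [← hΦapp]; exact Φ.apply_symm_apply q
  -- (10) the `g_p`-norm, normalizations and the radial exit map `R`
  set Bp : EuclideanSpace ℝ (Fin (m + 1 + 1)) →L[ℝ] EuclideanSpace ℝ (Fin (m + 1 + 1)) →L[ℝ] ℝ :=
    G.val p with hBp
  have hBpos : ∀ w : EuclideanSpace ℝ (Fin (m + 1 + 1)), w ≠ 0 → 0 < Bp w w := fun w hw ↦ hGr p w hw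
  have hBnn : ∀ w : EuclideanSpace ℝ (Fin (m + 1 + 1)), 0 ≤ Bp w w := fun w ↦ by
    by_cases hw : w = 0
    · rw [hw]; simp
    · exact (hBpos w hw).le
  set Nm : EuclideanSpace ℝ (Fin (m + 1 + 1)) → ℝ := fun w ↦ Real.sqrt (Bp w w) with hNm
  have hNmpos : ∀ w, w ≠ 0 → 0 < Nm w := fun w hw ↦ Real.sqrt_pos.2 (hBpos w hw)
  have hNmsq : ∀ w, Nm w ^ 2 = Bp w w := fun w ↦ Real.sq_sqrt (hBnn w)
  have hBsmul : ∀ (r : ℝ) (w : EuclideanSpace ℝ (Fin (m + 1 + 1))), Bp (r • w) (r • w) = r ^ 2 * Bp w w := by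
    intro r w
    simp only [map_smul, smul_apply, smul_eq_mul]
    ring
  set nrm : EuclideanSpace ℝ (Fin (m + 1 + 1)) → EuclideanSpace ℝ (Fin (m + 1 + 1)) :=
    fun w ↦ (Nm w)⁻¹ • w with hnrm
  have hnrm_unit : ∀ w, w ≠ 0 → Bp (nrm w) (nrm w) = 1 := by
    intro w hw
    simp only [hnrm]
    rw [hBsmul, ← hNmsq w, inv_pow]
    exact inv_mul_cancel₀ (pow_ne_zero 2 (hNmpos w hw).ne')
  have hnrm_ne : ∀ w, w ≠ 0 → nrm w ≠ 0 := fun w hw h ↦ by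
    have := hnrm_unit w hw; rw [h] at this; simp at this
  have hw_eq : ∀ w, w ≠ 0 → w = Nm w • nrm w := fun w hw ↦ by
    simp only [hnrm]
    rw [smul_smul, mul_inv_cancel₀ (hNmpos w hw).ne', one_smul]
  have hNa : ∀ (r : ℝ) (w : EuclideanSpace ℝ (Fin (m + 1 + 1))), 0 < r → Nm (r • w) = r * Nm w := by
    intro r w hr
    simp only [hNm]
    rw [hBsmul, Real.sqrt_mul (sq_nonneg r), Real.sqrt_sq hr.le]
  have hnrm_smul : ∀ (r : ℝ) (w : EuclideanSpace ℝ (Fin (m + 1 + 1))), 0 < r → w ≠ 0 →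
      nrm (r • w) = nrm w := by
    intro r w hr hw
    simp only [hnrm]
    rw [hNa r w hr, mul_inv, smul_smul, mul_comm (r⁻¹), mul_assoc, inv_mul_cancel₀ hr.ne', mul_one]
  -- Euclidean normalization
  set enrm : EuclideanSpace ℝ (Fin (m + 1 + 1)) → EuclideanSpace ℝ (Fin (m + 1 + 1)) :=
    fun w ↦ ‖w‖⁻¹ • w with henrm
  have henrm_norm : ∀ w, w ≠ 0 → ‖enrm w‖ = 1 := by
    intro w hw
    simp only [henrm]
    rw [norm_smul, norm_inv, norm_norm, inv_mul_cancel₀ (norm_ne_zero_iff.2 hw)]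
  have henrm_smul : ∀ (r : ℝ) (w : EuclideanSpace ℝ (Fin (m + 1 + 1))), 0 < r → w ≠ 0 →
      enrm (r • w) = enrm w := by
    intro r w hr hw
    simp only [henrm]
    rw [norm_smul, Real.norm_eq_abs, abs_of_pos hr, mul_inv, smul_smul, mul_comm (r⁻¹), mul_assoc,
      inv_mul_cancel₀ hr.ne', mul_one]
  have henrm_id : ∀ w : EuclideanSpace ℝ (Fin (m + 1 + 1)), ‖w‖ = 1 → enrm w = w := by
    intro w hw; simp only [henrm]; rw [hw, inv_one, one_smul]
  have hnrm_enrm : ∀ w, w ≠ 0 → nrm (enrm w) = nrm w := fun w hw ↦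
    hnrm_smul _ w (inv_pos.2 (norm_pos_iff.2 hw)) hw
  have henrm_nrm : ∀ w, w ≠ 0 → enrm (nrm w) = enrm w := fun w hw ↦
    henrm_smul _ w (inv_pos.2 (hNmpos w hw)) hw
  -- the radial exit point `R w = τ(v) v`, `v = nrm w`
  set R : EuclideanSpace ℝ (Fin (m + 1 + 1)) → EuclideanSpace ℝ (Fin (m + 1 + 1)) :=
    fun w ↦ τ (nrm w) • nrm w with hR
  have hR_ne : ∀ w, w ≠ 0 → R w ≠ 0 := fun w hw ↦
    smul_ne_zero (hstruct (nrm w) (hnrm_unit w hw)).1.ne' (hnrm_ne w hw)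
  have hR_level : ∀ w, w ≠ 0 → u (F (R w)) = ε := by
    intro w hw
    obtain ⟨-, h2', -, -⟩ := hstruct (nrm w) (hnrm_unit w hw)
    have hFR : F (R w) = maximalGeodesic G.leviCivita p
        (show TangentSpace (𝓡 (m + 1 + 1)) p from nrm w) (τ (nrm w)) := expMap_smul hc p _ _
    rw [hFR]
    exact h2'
  have hR_smul : ∀ (r : ℝ) (w : EuclideanSpace ℝ (Fin (m + 1 + 1))), 0 < r → w ≠ 0 → R (r • w) = R w := by
    intro r w hr hw; simp only [hR]; rw [hnrm_smul r w hr hw]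
  -- a vector whose image lies on the level is its own exit point: `R w = w`
  have hR_of_level : ∀ w, w ≠ 0 → u (F w) = ε → R w = w := by
    intro w hw hlev
    obtain ⟨h1', h2', h3', h4'⟩ := hstruct (nrm w) (hnrm_unit w hw)
    have hFw : F w = maximalGeodesic G.leviCivita p (nrm w) (Nm w) := by
      show expMap G.leviCivita p _ = _
      conv_lhs => rw [hw_eq w hw]
      exact expMap_smul hc p _ (Nm w)
    rw [hFw] at hlev
    -- `Nm w = τ (nrm w)` since the level is only hit at the exit time
    have hNτ : Nm w = τ (nrm w) := by
      rcases lt_trichotomy (Nm w) (τ (nrm w)) with hlt | heq | hgt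
      · exact absurd hlev (h3' _ ⟨(hNmpos w hw).le, hlt⟩).ne'
      · exact heq
      · exact absurd hlev (h4' _ hgt).ne
    simp only [hR]
    rw [← hNτ]
    exact (hw_eq w hw).symm
  -- (11) the maps
  haveI hfact : Fact (Module.finrank ℝ (EuclideanSpace ℝ (Fin (m + 1 + 1))) = m + 1 + 1) :=
    ⟨finrank_euclideanSpace_fin⟩
  set h₀ : ℝ := ε * (2 / a) with hh₀
  have hh₀mem : h₀ ∈ Ico (0 : ℝ) c.top := by
    rw [hctop]
    refine ⟨by positivity, ?_⟩
    rw [hh₀, mul_div_assoc', div_lt_iff₀ ha]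
    linarith
  set kk : B → X := fun y ↦ c.toFun y h₀ with hkk
  have hkρ : ∀ y, ρ (kk y) = ε := by
    intro y
    have h := c.height_apply y h₀ hh₀mem
    rw [hcheight] at h
    have ha0 : a ≠ 0 := ha.ne'
    show ρ (c.toFun y h₀) = ε
    have : ρ (c.toFun y h₀) * (2 / a) = ε * (2 / a) := h
    field_simp at this
    linarith
  have hk_range : ∀ y, kk y ∈ range j := by
    intro y
    rw [hjr, ← ModelWithCorners.compl_boundary]
    intro hb'
    have := (hρb _).2 hb'
    rw [hkρ] at this
    exact hεpos.ne' this
  set jinv : X → N := Function.invFun j with hjinv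
  have hjk : ∀ y, j (jinv (kk y)) = kk y := fun y ↦ Function.invFun_eq (hk_range y)
  have hjinv_j : ∀ q, jinv (j q) = q := Function.leftInverse_invFun hje.injective
  have huk : ∀ y, u (jinv (kk y)) = ε := fun y ↦ by
    show ρ (j (jinv (kk y))) = ε; rw [hjk, hkρ]
  have hw_ne : ∀ y, Φ.symm (jinv (kk y)) ≠ 0 := by
    intro y h
    have h1 : F (Φ.symm (jinv (kk y))) = jinv (kk y) := hΦsymm' _
    rw [h, hF0] at h1
    have h2 := huk y
    rw [← h1] at h2
    exact absurd h2 hεp.ne'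
  -- the maps `Th : sphere → B` and `La : B → sphere`
  have hsph_ne : ∀ (sv : Metric.sphere (0 : EuclideanSpace ℝ (Fin (m + 1 + 1))) 1),
      (sv : EuclideanSpace ℝ (Fin (m + 1 + 1))) ≠ 0 := fun sv ↦ ne_zero_of_mem_unit_sphere sv
  set θ : EuclideanSpace ℝ (Fin (m + 1 + 1)) → B := fun w ↦ c.proj (j (F (R w))) with hθ
  set Th : Metric.sphere (0 : EuclideanSpace ℝ (Fin (m + 1 + 1))) 1 → B := fun sv ↦ θ sv with hTh_def
  set lam : B → EuclideanSpace ℝ (Fin (m + 1 + 1)) := fun y ↦ enrm (Φ.symm (jinv (kk y))) with hlam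
  have hlam_mem : ∀ y, lam y ∈ Metric.sphere (0 : EuclideanSpace ℝ (Fin (m + 1 + 1))) 1 := fun y ↦ by
    rw [mem_sphere_zero_iff_norm]
    exact henrm_norm _ (hw_ne y)
  set La : B → Metric.sphere (0 : EuclideanSpace ℝ (Fin (m + 1 + 1))) 1 :=
    Set.codRestrict lam _ hlam_mem with hLa_def
  -- the region of the collar contains the level `{ρ = ε}`
  have hregion : ∀ x : X, ρ x = ε → x ∈ c.region := fun x hx ↦ by
    rw [hcreg]; show ρ x < a; rw [hx]; exact hεa
  -- (12) `Th ∘ La = id`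
  have hThLa : ∀ y, Th (La y) = y := by
    intro y
    set w := Φ.symm (jinv (kk y)) with hw
    have hw0 : w ≠ 0 := hw_ne y
    have hFw : F w = jinv (kk y) := hΦsymm' _
    have hRw : R (enrm w) = w := by
      rw [show R (enrm w) = R w from hR_smul _ w (inv_pos.2 (norm_pos_iff.2 hw0)) hw0]
      exact hR_of_level w hw0 (by rw [hFw]; exact huk y)
    show c.proj (j (F (R (enrm w)))) = y
    rw [hRw, hFw, hjk]
    exact c.proj_apply y h₀ hh₀mem
  -- (13) `La ∘ Th = id`
  have hLaTh : ∀ sv, La (Th sv) = sv := by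
    intro sv
    have hsv0 := hsph_ne sv
    apply Subtype.ext
    show enrm (Φ.symm (jinv (kk (c.proj (j (F (R sv))))))) = sv
    set x : X := j (F (R sv)) with hx
    have hρx : ρ x = ε := hR_level sv hsv0
    have hkx : kk (c.proj x) = x := by
      show c.toFun (c.proj x) h₀ = x
      have hhx : c.height x = h₀ := by rw [hcheight, hρx]
      rw [← hhx]
      exact c.apply_proj_height x (hregion x hρx)
    rw [hkx, hx, hjinv_j, hΦsymm]
    show enrm (τ (nrm sv) • nrm sv) = sv
    rw [henrm_smul _ _ (hstruct (nrm sv) (hnrm_unit sv hsv0)).1 (hnrm_ne sv hsv0), henrm_nrm sv hsv0]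
    exact henrm_id sv (by simpa only [mem_sphere_zero_iff_norm] using sv.2)
  -- (14) smoothness of `Th`
  have hne_open : IsOpen {w : EuclideanSpace ℝ (Fin (m + 1 + 1)) | w ≠ 0} := isOpen_ne
  have hnrm_d : ContDiffOn ℝ ∞ nrm {w | w ≠ 0} := contDiffOn_formNormalize Bp hBpos
  have hnrm_maps : MapsTo nrm {w | w ≠ 0} U := fun w hw ↦ hSU (hnrm_unit w hw)
  have hR_d : ContDiffOn ℝ ∞ R {w | w ≠ 0} :=
    ((hτd.comp hnrm_d hnrm_maps).smul hnrm_d)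
  have hR_md : ContMDiffOn 𝓘(ℝ, EuclideanSpace ℝ (Fin (m + 1 + 1))) 𝓘(ℝ, EuclideanSpace ℝ (Fin (m + 1 + 1)))
      ∞ R {w | w ≠ 0} := hR_d.contMDiffOn
  have hjF : ContMDiffOn 𝓘(ℝ, EuclideanSpace ℝ (Fin (m + 1 + 1))) (𝓡∂ (m + 1 + 1)) ∞
      (fun w ↦ j (F (R w))) {w | w ≠ 0} :=
    (hj.contMDiff.comp hFs).comp_contMDiffOn hR_md
  have hθ_d : ContMDiffOn 𝓘(ℝ, EuclideanSpace ℝ (Fin (m + 1 + 1))) (𝓡 (m + 1)) ∞ θ {w | w ≠ 0} :=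
    c.contMDiffOn_proj.comp hjF fun w hw ↦ hregion _ (hR_level w hw)
  have hThs : ContMDiff (𝓡 (m + 1)) (𝓡 (m + 1)) ∞ Th :=
    hθ_d.comp_contMDiff contMDiff_coe_sphere fun sv ↦ hsph_ne sv
  -- (15) smoothness of `La`
  have hkk_s : ContMDiff (𝓡 (m + 1)) (𝓡∂ (m + 1 + 1)) ∞ kk :=
    c.contMDiffOn_toFun.comp_contMDiff (f := fun y : B ↦ (y, h₀))
      (contMDiff_id.prodMk contMDiff_const) fun y ↦ ⟨mem_univ _, hh₀mem⟩
  have hjk_fun : (fun y ↦ j (jinv (kk y))) = kk := funext hjk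
  have hik_c : Continuous fun y ↦ jinv (kk y) := by
    rw [hje.isInducing.continuous_iff, Function.comp_def, hjk_fun]
    exact hkk_s.continuous
  have hik_s : ContMDiff (𝓡 (m + 1)) (𝓡 (m + 1 + 1)) ∞ fun y ↦ jinv (kk y) := by
    intro y
    refine (ContMDiffAt.iff_comp_isImmersionAt (hj.isImmersion.isImmersionAt _)).2
      ⟨hik_c.continuousAt, ?_⟩
    rw [Function.comp_def, hjk_fun]
    exact hkk_s y
  have henrm_d : ContMDiffOn 𝓘(ℝ, EuclideanSpace ℝ (Fin (m + 1 + 1))) 𝓘(ℝ, EuclideanSpace ℝ (Fin (m + 1 + 1)))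
      ∞ enrm {w | w ≠ 0} := contDiffOn_normalize.contMDiffOn
  have hlam_s : ContMDiff (𝓡 (m + 1)) 𝓘(ℝ, EuclideanSpace ℝ (Fin (m + 1 + 1))) ∞ lam :=
    henrm_d.comp_contMDiff (Φ.symm.contMDiff.comp hik_s) fun y ↦ hw_ne y
  have hLas : ContMDiff (𝓡 (m + 1)) (𝓡 (m + 1)) ∞ La := hlam_s.codRestrict_sphere hlam_mem
  -- (16) the diffeomorphism
  refine ⟨⟨⟨La, Th, hThLa, hLaTh⟩, hLas, hThs⟩⟩
end SimpleAH

end Literature.Geometry.Riemannian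

end
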